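import Summits.FinalStateConjecture.FinalStateConjecture.Theses.ExactKerrEnds
import Summits.FinalStateConjecture.FinalStateConjecture.Theses.TangentProfileCensorship
import Summits.FinalStateConjecture.FinalStateConjecture.Theses.CurvatureOrSymmetry
import Literature.Geometry.Lorentzian.TameBreathingCurve
import Literature.Geometry.Lorentzian.CauchyDevelopmentPrecomp

/-!
# Crux `CensorshipAlongKerrEnds` (stmt-FinalStateConjecture-18521) — ideator 1, round 1: SKETCH for the
# crux idea `transplant-the-end` (lean check rc 0, 0 sorries, 0 warnings)

* §1 short forms of the crux's let-bound legend (`KerrEnded`, `Censored`), the Statement's settling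
  property (`Settled`, verbatim the "good" property of `FinalStateConjecture` and of the summit's two
  settled exits), agreement of two data on a set (`AgreeOn`);
* §2 the NEW object: `LateAbsorption` — along a tame admissible family, on every compact parameter set of
  SETTLED members, one compact agreement core `K₀` and one weighted tolerance `δ` make every admissible
  modification off `K₀` within `δ` CENSORED (single-datum form `LateAbsorptionAt`; window form
  `LateAbsorptionW`, derived: `lateAbsorptionW_of_lateAbsorption`, PROVED);
* §3 the adapters: `RecedingKerrGluing` (Corvino–Schoen re-gluing to exact Kerr ends ALONG a tame curve with
  prescribed, locally bounded agreement cores and tolerances — the parametric form of the route's rank-4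
  crux `TameEscapeToKerrEnds`), `SettledTameAccess`, `WindowUpgrade` (Stub 1 of `base-point-reduction`);
* §4 `censorshipAlongKerrEnds_of_transplant : WindowUpgrade → SettledTameAccess → RecedingKerrGluing →
  LateAbsorption → CensorshipAlongKerrEnds`, PROVED (concludes the crux BY NAME; the base datum may be any
  admissible datum, so both physical stubs of `base-point-reduction` are covered at once);
* §5 `settledTameAccess_of_exits : MGHDExists → NakedDataTameExit → TameCensoredDataExit → SettledBreathing →
  SettledTameAccess`, PROVED, importing the summit's items BY NAME (stmt-9937; stmt-17383 of
  TangentProfileCensorship; `CurvatureOrSymmetry.TameCensoredDataExit`), and the end-to-end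
  `censorshipAlongKerrEnds_of_exits_gluing_absorption` whose only unregistered hypotheses are the two
  bookkeeping Props (`WindowUpgrade`, `SettledBreathing`), the parametric gluing and `LateAbsorption`;
  and the logical position of C₁: `settledTameAccess_of_finalStateConjecture`, `censorshipAlongKerrEnds_of_summit`
  (the Statement + the adapters ⟹ C₁), PROVED.
-/

noncomputable section

set_option linter.dupNamespace false
set_option linter.unusedSectionVars false

open Set Function Filter
open scoped Manifold ContDiff Topology ENNReal

namespace Summit.FinalStateConjecture.FinalStateConjecture.Cruxes.CensorshipAlongKerrEnds.Ideator1

open Literature.Geometry.Lorentzian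
open Summit.FinalStateConjecture.FinalStateConjecture.Theses.ExactKerrEnds (CensorshipAlongKerrEnds)

/-! ## §1 Short forms -/
section ShortForms

variable {X : Type} [TopologicalSpace X] [ChartedSpace E3 X] [IsManifold (𝓡 3) ∞ X] [T2Space X]
  [SecondCountableTopology X] [ConnectedSpace X]

/-- `KerrEnded D` — verbatim the crux's let-bound legend. [cite: CorvinoSchoen2006, Thm. 5] -/
def KerrEnded (D : InitialDataSet (𝓡 3) X) : Prop :=
  ∀ [Kerr.Facts], ∃ (K : Set X) (U : TopologicalSpace.Opens E3) (M a r₀ : ℝ) (hM : 0 ≤ M) (φ : U → X)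
    (ψ : U → Kerr.region a r₀) (ν : NormalField 𝓘(ℝ, E4) ψ),
    IsCompact K ∧ Kᶜ ⊆ range φ ∧ Topology.IsOpenEmbedding φ ∧
      ContMDiff 𝓘(ℝ, E3) (𝓡 3) ((⊤ : ℕ∞) : WithTop ℕ∞) φ ∧ Injective ψ ∧
      (Kerr.smoothMetric M a r₀).IsSpacelikeImmersion 𝓘(ℝ, E3) ψ ∧
      (Kerr.smoothMetric M a r₀).IsFutureUnitNormal 𝓘(ℝ, E3)
        ((Kerr.timeOrientation M a r₀ hM).ofLE le_top) ψ ν ∧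
      (∀ (y : U) (v w : E3), φ y ∉ K →
        D.h.inner (φ y) (mfderiv 𝓘(ℝ, E3) (𝓡 3) φ y v) (mfderiv 𝓘(ℝ, E3) (𝓡 3) φ y w) =
          Kerr.bilin M a (ψ y : E4) (mfderiv 𝓘(ℝ, E3) 𝓘(ℝ, E4) ψ y v)
            (mfderiv 𝓘(ℝ, E3) 𝓘(ℝ, E4) ψ y w)) ∧
      (∀ [(Kerr.smoothMetric M a r₀).HasLeviCivita] (y : U) (v w : E3), φ y ∉ K →
        D.k (φ y) (mfderiv 𝓘(ℝ, E3) (𝓡 3) φ y v) (mfderiv 𝓘(ℝ, E3) (𝓡 3) φ y w) =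
          (Kerr.smoothMetric M a r₀).secondFundamentalForm 𝓘(ℝ, E3) ψ ν y v w)

/-- `Censored D` — every maximal vacuum Cauchy development has complete `𝓘⁺` (sojourn form).
[cite: Christodoulou1999, pp. A26–A27] -/
def Censored (D : InitialDataSet (𝓡 3) X) : Prop :=
  ∀ 𝒟 : VacuumCauchyDevelopment D, 𝒟.IsMaximal →
    Summit.FinalStateConjecture.HasCompleteNullInfinity 𝒟.toCauchyDevelopment

/-- `Settled D` — VERBATIM the property whose tame genericity the Statement asserts: an MGHD exists and
every MGHD has complete `𝓘⁺` and a sub-extremal `N`-Kerr final-state decomposition of its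
self-determined exterior with `RaysStayInClosure`, `HasExhaustiveCharts`, `IsFutureOriented`.
[cite: DafermosLuk2017, Conjecture 1] -/
def Settled (D : InitialDataSet (𝓡 3) X) : Prop :=
  (∃ 𝒟 : VacuumCauchyDevelopment D, 𝒟.IsMaximal) ∧
    ∀ 𝒟 : VacuumCauchyDevelopment D, 𝒟.IsMaximal →
      Summit.FinalStateConjecture.HasCompleteNullInfinity 𝒟.toCauchyDevelopment ∧
        ∃ (O : Set 𝒟.carrier) (d : FinalStateDecomposition 𝒟.toSpacetime O 2),
          (∀ i, Kerr.IsSubextremal (d.mass i) (d.spin i)) ∧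
            O = Summit.FinalStateConjecture.exteriorOf 𝒟.toCauchyDevelopment d.charted ∧
              Summit.FinalStateConjecture.RaysStayInClosure 𝒟.toCauchyDevelopment O ∧
                Summit.FinalStateConjecture.HasExhaustiveCharts d ∧
                  Summit.FinalStateConjecture.IsFutureOriented d

/-- `AgreeOn D D' S` — the datum `D'` has the same metric and second fundamental form as `D` at every
point of `S` (so a "modification of `D` off `S`"). [folklore] -/
def AgreeOn (D D' : InitialDataSet (𝓡 3) X) (S : Set X) : Prop :=
  ∀ x ∈ S, D'.h.inner x = D.h.inner x ∧ D'.k x = D.k x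

/-- Agreement is antitone in the set. [folklore] -/
theorem AgreeOn.mono {D D' : InitialDataSet (𝓡 3) X} {S T : Set X} (h : AgreeOn D D' T) (hST : S ⊆ T) :
    AgreeOn D D' S :=
  fun x hx ↦ h x (hST hx)

end ShortForms

/-! ## §2 The new object: LATE ABSORPTION -/

/-- **Late absorption (locally uniform along tame families).** Let `G` be a tame family of admissible
data on the end `e` and `C` a compact set of parameters all of whose members are SETTLED. Then there
are ONE compact `K₀ ⊆ X` and ONE tolerance `δ > 0` such that, for every `c ∈ C`, every admissible datum
`D'` agreeing with `G c` on `K₀` and within weighted `C²₋₁ × C¹₋₂` distance `δ` of `G c` on `e` is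
CENSORED. Physics: the modification lives off `K₀`, so by domain of dependence it reaches the near zone
only at advanced time `≳ radius(K₀)`, after the member has settled to within any tolerance of its
sub-extremal Kerr end state(s); it arrives as quasi-static incoming radiation of amplitude `O(δ)`,
frequency `O(1/R)` and energy `O(δ²/R)`; censoredness then follows from asymptotic stability of the
settled state (N = 1: sub-extremal Kerr stability from a late scri-asymptotic leaf — Hintz 2026 /
Klainerman–Szeftel 2023 —, Klainerman–Nicolò exterior completeness for the far region, Cauchy
stability on the compact slab, ascent of sojourn-completeness along embeddings; N = 0: stability of
large dispersive solutions, Luk–Oh; N ≥ 2: late stability of receding Kerr clusters, OPEN).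
[cite: Hintz2026, Thm. 1.1] [cite: KlainermanNicolo2003, Thm. 3.7.1] -/
def LateAbsorption : Prop :=
  ∀ (X : Type) [TopologicalSpace X] [ChartedSpace E3 X] [IsManifold (𝓡 3) ∞ X] [T2Space X]
    [SecondCountableTopology X] [ConnectedSpace X],
    ∀ (e : AFEnd X) (G : EuclideanSpace ℝ (Fin 1) → InitialDataSet (𝓡 3) X),
      InitialDataSet.IsTameDataFamily e 1 G → (∀ c, G c ∈ admissibleVacuumData X) →
        ∀ C : Set (EuclideanSpace ℝ (Fin 1)), IsCompact C → (∀ c ∈ C, Settled (G c)) →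
          ∃ (K₀ : Set X) (δ : ℝ≥0∞), IsCompact K₀ ∧ 0 < δ ∧
            ∀ c ∈ C, ∀ D' ∈ admissibleVacuumData X,
              AgreeOn (G c) D' K₀ → e.wDist D' (G c) < δ → Censored D'

/-- The single-datum form (the case of a constant family): what a prover attacks first. -/
def LateAbsorptionAt : Prop :=
  ∀ (X : Type) [TopologicalSpace X] [ChartedSpace E3 X] [IsManifold (𝓡 3) ∞ X] [T2Space X]
    [SecondCountableTopology X] [ConnectedSpace X],
    ∀ (e : AFEnd X), ∀ D ∈ admissibleVacuumData X, Settled D →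
      ∃ (K₀ : Set X) (δ : ℝ≥0∞), IsCompact K₀ ∧ 0 < δ ∧
        ∀ D' ∈ admissibleVacuumData X, AgreeOn D D' K₀ → e.wDist D' D < δ → Censored D'

/-- The family form contains the single-datum form (singleton parameter set, constant family; a constant
admissible family is tame on the sole DR end of its datum — on any other end the weighted hypothesis is
read on that end as well, so we state the reduction for the datum's own DR end). [folklore] -/
theorem lateAbsorptionAt_of_lateAbsorption (h : LateAbsorption) :
    ∀ (X : Type) [TopologicalSpace X] [ChartedSpace E3 X] [IsManifold (𝓡 3) ∞ X] [T2Space X]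
      [SecondCountableTopology X] [ConnectedSpace X],
      ∀ (e : AFEnd X), e.IsSoleEnd → ∀ D ∈ admissibleVacuumData X, (∃ M, e.IsStronglyAsymptoticallyFlatDR D M) →
        Settled D →
        ∃ (K₀ : Set X) (δ : ℝ≥0∞), IsCompact K₀ ∧ 0 < δ ∧
          ∀ D' ∈ admissibleVacuumData X, AgreeOn D D' K₀ → e.wDist D' D < δ → Censored D' := by
  intro X _ _ _ _ _ _ e he D hD hM hS
  obtain ⟨M, hM⟩ := hM
  have htame : InitialDataSet.IsTameDataFamily e 1 (fun _ : EuclideanSpace ℝ (Fin 1) ↦ D) :=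
    InitialDataSet.isTameDataFamily_const he 1 hM
  obtain ⟨K₀, δ, hK₀, hδ, hcens⟩ :=
    h X e (fun _ ↦ D) htame (fun _ ↦ hD) {0} isCompact_singleton (fun _ _ ↦ hS)
  exact ⟨K₀, δ, hK₀, hδ, fun D' hD' hag hw ↦ hcens 0 (mem_singleton 0) D' hD' hag hw⟩


/-- **Late absorption, window form** (the shape the composition consumes): along a tame admissible family
whose members on the punctured window `{0 < ‖c‖ < ε}` are settled, agreement cores `K₀ c` and tolerances
`δ c` can be chosen LOCALLY BOUNDEDLY on compact parameter sets avoiding `0` such that every admissible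
modification of `G c` off `K₀ c` within `δ c` is censored, for `0 < ‖c‖ < ε/2`. Follows from `LateAbsorption` by a countable
exhaustion of the punctured window by nested compact annuli (bookkeeping, `lateAbsorptionW_of_lateAbsorption`). -/
def LateAbsorptionW : Prop :=
  ∀ (X : Type) [TopologicalSpace X] [ChartedSpace E3 X] [IsManifold (𝓡 3) ∞ X] [T2Space X]
    [SecondCountableTopology X] [ConnectedSpace X],
    ∀ (e : AFEnd X) (G : EuclideanSpace ℝ (Fin 1) → InitialDataSet (𝓡 3) X),
      InitialDataSet.IsTameDataFamily e 1 G → (∀ c, G c ∈ admissibleVacuumData X) →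
        ∀ ε > (0 : ℝ), (∀ c, c ≠ 0 → ‖c‖ < ε → Settled (G c)) →
          ∃ (K₀ : EuclideanSpace ℝ (Fin 1) → Set X) (δ : EuclideanSpace ℝ (Fin 1) → ℝ≥0∞),
            (∀ C : Set (EuclideanSpace ℝ (Fin 1)), IsCompact C → (0 : EuclideanSpace ℝ (Fin 1)) ∉ C →
                ∃ (K : Set X) (δ₀ : ℝ≥0∞), IsCompact K ∧ 0 < δ₀ ∧ ∀ c ∈ C, K₀ c ⊆ K ∧ δ₀ ≤ δ c) ∧
              ∀ c, c ≠ 0 → ‖c‖ < ε / 2 → ∀ D' ∈ admissibleVacuumData X,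
                AgreeOn (G c) D' (K₀ c) → e.wDist D' (G c) < δ c → Censored D'

/-- Bookkeeping: the per-compact form gives the window form (nested compact annuli
`{ε/(n+3) ≤ ‖c‖ ≤ ε/2}` exhaust `{0 < ‖c‖ ≤ ε/2}`; take for `c` the data of the least annulus containing
it; a compact set avoiding `0` stays outside a ball around `0`, hence inside finitely many annuli).
[folklore] -/
theorem lateAbsorptionW_of_lateAbsorption (h : LateAbsorption) : LateAbsorptionW := by
  classical
  intro X _ _ _ _ _ _ e G hGt hGadm ε hε hset
  -- nested compact annuli `A n = {ε/(n+4) ≤ ‖c‖ ≤ ε/2}` exhausting `{0 < ‖c‖ ≤ ε/2}`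
  set A : ℕ → Set (EuclideanSpace ℝ (Fin 1)) := fun n ↦ {c | ε / (n + 4) ≤ ‖c‖ ∧ ‖c‖ ≤ ε / 2} with hA
  have hAcpt : ∀ n, IsCompact (A n) := by
    intro n
    refine (isCompact_closedBall (0 : EuclideanSpace ℝ (Fin 1)) (ε / 2)).of_isClosed_subset ?_ ?_
    · exact (isClosed_le continuous_const continuous_norm).inter
        (isClosed_le continuous_norm continuous_const)
    · intro c hc
      simpa [mem_closedBall_zero_iff] using hc.2
  have hAset : ∀ n, ∀ c ∈ A n, Settled (G c) := by
    intro n c hc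
    have hpos : 0 < ε / (n + 4) := by positivity
    refine hset c ?_ ?_
    · intro h0
      have : ‖c‖ = 0 := by simp [h0]
      linarith [hc.1]
    · linarith [hc.2]
  choose K₀ δ hK₀ hδ habs using fun n ↦ h X e G hGt hGadm (A n) (hAcpt n) (hAset n)
  -- every `c ≠ 0` lies above some inner radius
  have hex : ∀ c : EuclideanSpace ℝ (Fin 1), c ≠ 0 → ∃ n : ℕ, ε / (n + 4) ≤ ‖c‖ := by
    intro c hc
    have hcpos : 0 < ‖c‖ := norm_pos_iff.mpr hc
    obtain ⟨n, hn⟩ := exists_nat_gt (ε / ‖c‖)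
    refine ⟨n, ?_⟩
    rw [div_le_iff₀ (by positivity)]
    have h1 : ε < n * ‖c‖ := by rwa [div_lt_iff₀ hcpos] at hn
    nlinarith
  -- the data of the least annulus containing `c`
  let idx : EuclideanSpace ℝ (Fin 1) → ℕ := fun c ↦ if hc : c ≠ 0 then Nat.find (hex c hc) else 0
  have hidx_spec : ∀ c (hc : c ≠ 0), ε / (idx c + 4) ≤ ‖c‖ := by
    intro c hc
    have : idx c = Nat.find (hex c hc) := by simp [idx, hc]
    rw [this]
    exact_mod_cast Nat.find_spec (hex c hc)
  have hidx_le : ∀ c (hc : c ≠ 0) (N : ℕ), ε / (N + 4) ≤ ‖c‖ → idx c ≤ N := by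
    intro c hc N hN
    have : idx c = Nat.find (hex c hc) := by simp [idx, hc]
    rw [this]
    exact Nat.find_min' (hex c hc) hN
  refine ⟨fun c ↦ K₀ (idx c), fun c ↦ δ (idx c), ?_, ?_⟩
  · -- local boundedness on compact sets avoiding `0`
    intro C hC h0
    obtain ⟨η, hη, hball⟩ := Metric.isOpen_iff.mp hC.isClosed.isOpen_compl 0 h0
    obtain ⟨N, hN⟩ := exists_nat_gt (ε / η)
    have hNη : ε / (N + 4) ≤ η := by
      rw [div_le_iff₀ (by positivity)]
      have h1 : ε < N * η := by rwa [div_lt_iff₀ hη] at hN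
      nlinarith
    have hidxC : ∀ c ∈ C, idx c ≤ N := by
      intro c hc
      have hc0 : c ≠ 0 := fun h ↦ h0 (h ▸ hc)
      have hcη : η ≤ ‖c‖ := by
        by_contra hlt
        push Not at hlt
        exact hball (mem_ball_zero_iff.mpr hlt) hc
      exact hidx_le c hc0 N (hNη.trans hcη)
    refine ⟨⋃ n ∈ Finset.range (N + 1), K₀ n, (Finset.range (N + 1)).inf' ⟨0, by simp⟩ δ,
      (Finset.range (N + 1)).isCompact_biUnion fun n _ ↦ hK₀ n, ?_, ?_⟩
    · exact (Finset.lt_inf'_iff _).mpr fun n _ ↦ hδ n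
    · intro c hc
      have hmem : idx c ∈ Finset.range (N + 1) := Finset.mem_range.mpr (Nat.lt_succ_of_le (hidxC c hc))
      exact ⟨Set.subset_biUnion_of_mem (u := fun n ↦ K₀ n) (Finset.mem_coe.mpr hmem),
        Finset.inf'_le _ hmem⟩
  · -- absorption on the half window
    intro c hc hcε D' hD' hag hw
    have hcA : c ∈ A (idx c) := ⟨hidx_spec c hc, hcε.le⟩
    exact habs (idx c) c hcA D' hD' hag hw

/-! ## §3 The two adapters -/
section Adapters

/-- **Receding Kerr gluing along a tame curve** (parametric Corvino–Schoen; the route's rank-4 crux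
`TameEscapeToKerrEnds` is its constant-family case without prescribed cores). Given a tame, immersed
family `G` of admissible data on `e` and prescribed agreement cores `K₀ c` and tolerances `δ c`
(locally bounded on compact parameter sets avoiding `0`), there is a tame immersed family `F'` on the
same end, same base datum, admissible, whose members off `0` are KERR-ENDED, agree with `G c` on `K₀ c`
and are `δ c`-close to `G c` in the weighted distance (glue `G c` to an exact Kerr leaf beyond a smooth
radius `R(c) ≥` everything prescribed, `R(c) → ∞` as `c → 0`). [cite: CorvinoSchoen2006, Thms. 1, 4, 5]
[cite: ChruscielDelay2003, Thm. 8.1] -/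
def RecedingKerrGluing : Prop :=
  ∀ (X : Type) [TopologicalSpace X] [ChartedSpace E3 X] [IsManifold (𝓡 3) ∞ X] [T2Space X]
    [SecondCountableTopology X] [ConnectedSpace X],
    ∀ (e : AFEnd X) (G : EuclideanSpace ℝ (Fin 1) → InitialDataSet (𝓡 3) X),
      InitialDataSet.IsTameDataFamily e 1 G → InitialDataSet.IsImmersedAtZero 1 G →
        (∀ c, G c ∈ admissibleVacuumData X) →
        ∀ (K₀ : EuclideanSpace ℝ (Fin 1) → Set X) (δ : EuclideanSpace ℝ (Fin 1) → ℝ≥0∞),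
          (∀ C : Set (EuclideanSpace ℝ (Fin 1)), IsCompact C → (0 : EuclideanSpace ℝ (Fin 1)) ∉ C →
              ∃ (K : Set X) (δ₀ : ℝ≥0∞), IsCompact K ∧ 0 < δ₀ ∧ ∀ c ∈ C, K₀ c ⊆ K ∧ δ₀ ≤ δ c) →
          ∃ F' : EuclideanSpace ℝ (Fin 1) → InitialDataSet (𝓡 3) X,
            InitialDataSet.IsTameDataFamily e 1 F' ∧ InitialDataSet.IsImmersedAtZero 1 F' ∧
              F' 0 = G 0 ∧ (∀ c, F' c ∈ admissibleVacuumData X) ∧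
                ∀ c ≠ 0, KerrEnded (F' c) ∧ AgreeOn (G c) (F' c) (K₀ c) ∧ e.wDist (F' c) (G c) < δ c

/-- **Settled tame access at every admissible datum** (= `TangentProfileCensorship.NakedDataTameExit`
at non-censored data ∧ `CurvatureOrSymmetry.TameCensoredDataExit` at censored non-settled data ∧ the
breathing self-witness at settled data, settledness being transported along diffeomorphisms of `X`):
through every admissible `d` passes a tame immersed family of admissible data whose members on a
punctured window are settled. [cite: DafermosLuk2017, Conjecture 1] [cite: Christodoulou1999, p. A24] -/
def SettledTameAccess : Prop :=
  ∀ (X : Type) [TopologicalSpace X] [ChartedSpace E3 X] [IsManifold (𝓡 3) ∞ X] [T2Space X]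
    [SecondCountableTopology X] [ConnectedSpace X],
    ∀ d ∈ admissibleVacuumData X,
      ∃ (e : AFEnd X) (G : EuclideanSpace ℝ (Fin 1) → InitialDataSet (𝓡 3) X),
        InitialDataSet.IsTameDataFamily e 1 G ∧ InitialDataSet.IsImmersedAtZero 1 G ∧ G 0 = d ∧
          (∀ c, G c ∈ admissibleVacuumData X) ∧
            ∃ ε > (0 : ℝ), ∀ c, c ≠ 0 → ‖c‖ < ε → Settled (G c)

/-- Stub 1 of the registered line `base-point-reduction`, verbatim (WINDOW UPGRADE; shared). -/
def WindowUpgrade : Prop :=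
  ∀ (X : Type) [TopologicalSpace X] [ChartedSpace E3 X] [IsManifold (𝓡 3) ∞ X] [T2Space X]
    [SecondCountableTopology X] [ConnectedSpace X],
    ∀ (P : InitialDataSet (𝓡 3) X → Prop) (e : AFEnd X) (F : EuclideanSpace ℝ (Fin 1) → InitialDataSet (𝓡 3) X),
      InitialDataSet.IsTameDataFamily e 1 F → InitialDataSet.IsImmersedAtZero 1 F →
        (∃ ε > (0 : ℝ), ∀ c, c ≠ 0 → ‖c‖ < ε → P (F c)) →
          ∃ F' : EuclideanSpace ℝ (Fin 1) → InitialDataSet (𝓡 3) X,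
            InitialDataSet.IsTameDataFamily e 1 F' ∧ F' 0 = F 0 ∧ Injective F' ∧
              InitialDataSet.IsImmersedAtZero 1 F' ∧ ∀ c ≠ 0, P (F' c)

end Adapters

/-! ## §4 Composition shape (statement; its proof is logic + a dyadic annular exhaustion of the punctured
window `{0 < ‖c‖ ≤ ε/2}`, each compact annulus getting one `(K₀, δ)` from `LateAbsorption`, a compact set
avoiding `0` meeting finitely many annuli) -/

/-- **C₁ by transplanting the end (window form), PROVED.** Window upgrade, settled access, receding
Kerr gluing and late absorption (window form) imply the crux — for EVERY admissible base datum, Kerr-ended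
or not (so both physical stubs of `base-point-reduction`, `ChristodoulouAtKerrEndedData` and
`CensoredKerrEndedLanding`, at once); the crux's hypotheses on the input curve are not even used beyond
admissibility of its base. -/
theorem censorshipAlongKerrEnds_of_transplantW (hW : WindowUpgrade) (hA : SettledTameAccess)
    (hG : RecedingKerrGluing) (hL : LateAbsorptionW) : CensorshipAlongKerrEnds := by
  intro X _ _ _ _ _ _ KerrEnded' Censored' e F hF hshape hadm hKE
  have hd : F 0 ∈ admissibleVacuumData X := hadm 0
  obtain ⟨e₁, G, hGt, hGi, hG0, hGadm, ε, hε, hGset⟩ := hA X (F 0) hd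
  obtain ⟨K₀, δ, hbdd, habs⟩ := hL X e₁ G hGt hGadm ε hε hGset
  obtain ⟨F', hF't, hF'i, hF'0, hF'adm, hF'mem⟩ := hG X e₁ G hGt hGi hGadm K₀ δ hbdd
  have hP : ∃ ε' > (0 : ℝ), ∀ c, c ≠ 0 → ‖c‖ < ε' →
      (F' c ∈ admissibleVacuumData X ∧ KerrEnded (F' c) ∧ Censored (F' c)) :=
    ⟨ε / 2, half_pos hε, fun c hc hcε ↦ ⟨hF'adm c, (hF'mem c hc).1,
      habs c hc hcε (F' c) (hF'adm c) (hF'mem c hc).2.1 (hF'mem c hc).2.2⟩⟩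
  obtain ⟨F'', hF''t, hF''0, hF''inj, hF''i, hF''P⟩ :=
    hW X (fun D ↦ D ∈ admissibleVacuumData X ∧ KerrEnded D ∧ Censored D) e₁ F' hF't hF'i hP
  refine ⟨e₁, F'', hF''t, hF''0.trans (hF'0.trans hG0), hF''inj, hF''i, ?_, ?_⟩
  · intro c
    by_cases hc : c = 0
    · subst hc
      rw [hF''0, hF'0, hG0]
      exact hd
    · exact (hF''P c hc).1
  · intro c hc
    exact ⟨(hF''P c hc).2.1, (hF''P c hc).2.2⟩

/-- **C₁ by transplanting the end** (per-compact form of late absorption). -/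
theorem censorshipAlongKerrEnds_of_transplant (hW : WindowUpgrade) (hA : SettledTameAccess)
    (hG : RecedingKerrGluing) (hL : LateAbsorption) : CensorshipAlongKerrEnds :=
  censorshipAlongKerrEnds_of_transplantW hW hA hG (lateAbsorptionW_of_lateAbsorption hL)

/-! ## §5 Settled access is the summit's two settled exits (shared items) + MGHD existence + breathing -/
section Exits

open Summit.FinalStateConjecture.FinalStateConjecture.Theses.ExactKerrEnds (MGHDExists)
open Summit.FinalStateConjecture.FinalStateConjecture.Theses.TangentProfileCensorship (NakedDataTameExit)
open Summit.FinalStateConjecture.FinalStateConjecture.Theses.CurvatureOrSymmetry (TameCensoredDataExit)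

/-- **Settled breathing** (bookkeeping, M): through a SETTLED admissible datum passes a tame immersed
admissible family all of whose members are settled — the breathing curve of `d`
(`InitialDataSet.exists_tame_selfWitness` technology), settledness being transported along the breathing
diffeomorphisms (`VacuumCauchyDevelopment.forall_isMaximal_comap_iff`,
`hasCompleteFutureNullInfinity_precomp_iff`, and the same re-indexing for the decomposition clauses,
which live on the unchanged spacetime). [cite: Christodoulou1999, p. A24] -/
def SettledBreathing : Prop :=
  ∀ (X : Type) [TopologicalSpace X] [ChartedSpace E3 X] [IsManifold (𝓡 3) ∞ X] [T2Space X]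
    [SecondCountableTopology X] [ConnectedSpace X],
    ∀ d ∈ admissibleVacuumData X, Settled d →
      ∃ (e : AFEnd X) (G : EuclideanSpace ℝ (Fin 1) → InitialDataSet (𝓡 3) X),
        InitialDataSet.IsTameDataFamily e 1 G ∧ InitialDataSet.IsImmersedAtZero 1 G ∧ G 0 = d ∧
          (∀ c, G c ∈ admissibleVacuumData X) ∧ ∀ c, Settled (G c)

/-- **Settled tame access = MGHD existence + the two settled exits of the summit + settled breathing**,
PROVED (case split: non-censored base → `NakedDataTameExit` (stmt-17383, TangentProfileCensorship);
censored non-settled base → `TameCensoredDataExit` (CurvatureOrSymmetry); settled base → breathing). -/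
theorem settledTameAccess_of_exits (hM : MGHDExists) (hN : NakedDataTameExit)
    (hT : TameCensoredDataExit) (hB : SettledBreathing) : SettledTameAccess := by
  intro X _ _ _ _ _ _ d hd
  have hex : ∃ 𝒟 : VacuumCauchyDevelopment d, 𝒟.IsMaximal := hM X d hd
  by_cases hC : ∀ 𝒟 : VacuumCauchyDevelopment d, 𝒟.IsMaximal →
      Summit.FinalStateConjecture.HasCompleteNullInfinity 𝒟.toCauchyDevelopment
  · by_cases hS : ∀ 𝒟 : VacuumCauchyDevelopment d, 𝒟.IsMaximal →
        ∃ (O : Set 𝒟.carrier) (dd : FinalStateDecomposition 𝒟.toSpacetime O 2),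
          (∀ i, Kerr.IsSubextremal (dd.mass i) (dd.spin i)) ∧
            O = Summit.FinalStateConjecture.exteriorOf 𝒟.toCauchyDevelopment dd.charted ∧
              Summit.FinalStateConjecture.RaysStayInClosure 𝒟.toCauchyDevelopment O ∧
                Summit.FinalStateConjecture.HasExhaustiveCharts dd ∧
                  Summit.FinalStateConjecture.IsFutureOriented dd
    · -- settled base: breathe
      have hset : Settled d := ⟨hex, fun 𝒟 h𝒟 ↦ ⟨hC 𝒟 h𝒟, hS 𝒟 h𝒟⟩⟩
      obtain ⟨e, G, hGt, hGi, hG0, hGadm, hGs⟩ := hB X d hd hset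
      exact ⟨e, G, hGt, hGi, hG0, hGadm, 1, one_pos, fun c _ _ ↦ hGs c⟩
    · -- censored, not settled: the settling exit
      push Not at hS
      obtain ⟨𝒟, h𝒟, hno⟩ := hS
      obtain ⟨e, F, hFt, hFi, hF0, -, hFadm, ε, hε, hgood⟩ :=
        hT X d hd hex hC ⟨𝒟, h𝒟, fun ⟨O, dd, h1, h2, h3, h4, h5⟩ ↦ hno O dd h1 h2 h3 h4 h5⟩
      exact ⟨e, F, hFt, hFi, hF0, hFadm, ε, hε, fun c hc hcε ↦ hgood c hc hcε⟩
  · -- non-censored base: the censoring exit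
    push Not at hC
    obtain ⟨𝒟, h𝒟, hno⟩ := hC
    obtain ⟨e, F, hFt, hFi, hF0, -, hFadm, ε, hε, hgood⟩ := hN X d hd ⟨𝒟, h𝒟, hno⟩
    exact ⟨e, F, hFt, hFi, hF0, hFadm, ε, hε, fun c hc hcε ↦ hgood c hc hcε⟩

/-- **The full transfer, PROVED:** C₁ follows from two bookkeeping statements (`WindowUpgrade`,
`SettledBreathing`), three EXISTING items of the summit by name (`ExactKerrEnds.MGHDExists` = stmt-9937,
`TangentProfileCensorship.NakedDataTameExit` = stmt-17383, `CurvatureOrSymmetry.TameCensoredDataExit`),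
the parametric form of the route's own rank-4 crux (`RecedingKerrGluing`) and ONE new statement,
`LateAbsorption`. -/
theorem censorshipAlongKerrEnds_of_exits_gluing_absorption (hW : WindowUpgrade) (hB : SettledBreathing)
    (hM : MGHDExists) (hN : NakedDataTameExit) (hT : TameCensoredDataExit)
    (hG : RecedingKerrGluing) (hL : LateAbsorption) : CensorshipAlongKerrEnds :=
  censorshipAlongKerrEnds_of_transplant hW (settledTameAccess_of_exits hM hN hT hB) hG hL

/-- **Domination by the summit** (logical position of C₁, PROVED): the Statement itself, with settled breathing,
gives settled tame access — so `FinalStateConjecture ∧ SettledBreathing ∧ WindowUpgrade ∧ RecedingKerrGluing ∧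
LateAbsorption ⟹ C₁` (`censorshipAlongKerrEnds_of_summit`). Together with the census record
`C₁ ∧ TameEscapeToKerrEnds ⟹ WeakCosmicCensorshipTame` this sandwiches C₁ between the censorship half and the
full Statement, up to the two adapters. -/
theorem settledTameAccess_of_finalStateConjecture (hS : FinalStateConjecture) (hB : SettledBreathing) :
    SettledTameAccess := by
  intro X _ _ _ _ _ _ d hd
  by_cases hP : Settled d
  · obtain ⟨e, G, hGt, hGi, hG0, hGadm, hGs⟩ := hB X d hd hP
    exact ⟨e, G, hGt, hGi, hG0, hGadm, 1, one_pos, fun c _ _ ↦ hGs c⟩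
  · obtain ⟨e, F, hFt, hFi, hF0, -, hFadm, hgood⟩ := hS X d ⟨hd, hP⟩
    refine ⟨e, F, hFt, hFi, hF0, hFadm, 1, one_pos, fun c hc _ ↦ ?_⟩
    by_contra hns
    exact hgood c hc ⟨hFadm c, hns⟩

/-- C₁ from the summit plus the adapters (see `settledTameAccess_of_finalStateConjecture`). -/
theorem censorshipAlongKerrEnds_of_summit (hS : FinalStateConjecture) (hB : SettledBreathing) (hW : WindowUpgrade)
    (hG : RecedingKerrGluing) (hL : LateAbsorption) : CensorshipAlongKerrEnds :=
  censorshipAlongKerrEnds_of_transplant hW (settledTameAccess_of_finalStateConjecture hS hB) hG hL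

end Exits

end Summit.FinalStateConjecture.FinalStateConjecture.Cruxes.CensorshipAlongKerrEnds.Ideator1

end
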